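import Summits.AtomisticToContinuum.BoseEinsteinCondensation.Theorems.DeepInfraredEmptinessResponseComposition
import Summits.AtomisticToContinuum.BoseEinsteinCondensation.Theorems.DeepInfraredEmptinessFreeFlatness
import Summits.AtomisticToContinuum.BoseEinsteinCondensation.Theses.BECSectorPoincareTwoScale

/-!
# BlockLatticeFSum · residual `DeepInfraredEmptiness` (stmt-AtomisticToContinuum-27506) — «HYPERUNIFORM CARVING»: piece A from the SHARED crux
# `TorusHyperuniformity` (stmt-AtomisticToContinuum-9093) BY NAME, and the node of record `DeepInfraredEmptiness ⟸ 9093 ∧ LinearResponseGain (B)`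
# (decomp-a2c lens-6 «barrier-complement carving», generation 24: §4–§6, §8, §10 of the node file `HyperuniformCarving.lean` (sha256 9fc319fe…);
# def-free tree twin landed by prover hand 1 (g7) at the critic's licence row 350 (3) — `def`s inlined as texts, proofs verbatim; the free leaf
# `a = 0` is the landed `DeepInfraredEmptinessFreeFlatness.freeDensityFlatness_holds`, the compositions are `DeepInfraredEmptinessResponseComposition`)

* `deepDensityFlatness_of_pos_free` — piece A (`DeepDensityFlatness`) from its two halves `a > 0` / `a = 0` (case split on the scattering length);
* `structureFactorVar_indicator_cellN` — the structure factor of a cell-restricted state is the cell-restricted infimum;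
* `deepDensityFlatnessPos_of_torusHyperuniformity` — **A (a > 0) ⟸ `BECSectorPoincareTwoScale.TorusHyperuniformity` BY NAME** (real proof: `M₀ = 1`,
  `L = sideLength ρ N`, window constant `κ := √a/(2π√3)` so that `|m_j| ≤ κ√ρ L ⇒ |k| ≤ √(ρa)`, `σ := C`);
* `deepDensityFlatness_of_torusHyperuniformity(_free)`, `deepInfraredEmptiness_of_torusHyperuniformity(_free)_gain`,
  `deepPointwiseOne_of_torusHyperuniformity(_free)_gain` — THE NODE BY NAME: `TorusHyperuniformity (9093, shared open crux) → LinearResponseGain (B) →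
  BlockLatticeFSum.DeepInfraredEmptiness` (route decl) and `→ stub_deepPointwiseOne` (registered stub text).
Conditional only on B (and on the registered item 9093 taken by name).  All `[folklore]` bookkeeping over the cited tree results; no definitions; 0 sorry.
-/

noncomputable section

namespace Summit.AtomisticToContinuum.BoseEinsteinCondensation.Theorems.DeepInfraredEmptinessHyperuniformCarving

open Filter
open scoped ENNReal
open Summit.AtomisticToContinuum.BoseEinsteinCondensation.Theorems.DeepInfraredEmptinessResponseComposition

/-- case split on the scattering length (`a.toReal = 0 ↔ a = 0` for admissible `v`, `a ≠ ⊤`). -/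
theorem deepDensityFlatness_of_pos_free (hP : (∀ v : ℝ → ENNReal, Literature.MathematicalPhysics.QuantumManyBody.BoseGas.IsRepulsiveFiniteRange v → 0 < (Literature.MathematicalPhysics.QuantumManyBody.BoseGas.scatteringLength v).toReal → ∃ κ : ℝ, 0 < κ ∧ ∃ σ : ℝ, 0 < σ ∧ ∃ ρ₀ : ℝ, 0 < ρ₀ ∧ ∀ ρ : ℝ, 0 < ρ → ρ < ρ₀ → ∀ᶠ N : ℕ in Filter.atTop, ∃ δ : ENNReal, 0 < δ ∧ ∀ Ψ : Literature.MathematicalPhysics.QuantumManyBody.BoseGas.PeriodicTrialState N (Literature.MathematicalPhysics.QuantumManyBody.BoseGas.sideLength ρ N), Literature.MathematicalPhysics.QuantumManyBody.BoseGas.periodicEnergy v Ψ ≤ Literature.MathematicalPhysics.QuantumManyBody.BoseGas.periodicGroundStateEnergy v N (Literature.MathematicalPhysics.QuantumManyBody.BoseGas.sideLength ρ N) + δ → ∀ m : Fin 3 → ℤ, m ≠ 0 → (∀ j : Fin 3, |((m j : ℤ) : ℝ)| ≤ κ * Real.sqrt ρ * Literature.MathematicalPhysics.QuantumManyBody.BoseGas.sideLength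 ρ N) → Literature.MathematicalPhysics.QuantumManyBody.BoseGas.structureFactorVar N (Literature.MathematicalPhysics.QuantumManyBody.BoseGas.sideLength ρ N) ((Literature.MathematicalPhysics.QuantumManyBody.BoseGas.cellN N (Literature.MathematicalPhysics.QuantumManyBody.BoseGas.sideLength ρ N)).indicator Ψ.ψ) m ≤ ENNReal.ofReal σ * (N : ENNReal))) (hF : (∀ v : ℝ → ENNReal, Literature.MathematicalPhysics.QuantumManyBody.BoseGas.IsRepulsiveFiniteRange v → Literature.MathematicalPhysics.QuantumManyBody.BoseGas.scatteringLength v = 0 → ∃ κ : ℝ, 0 < κ ∧ ∃ σ : ℝ, 0 < σ ∧ ∃ ρ₀ : ℝ, 0 < ρ₀ ∧ ∀ ρ : ℝ, 0 < ρ → ρ < ρ₀ → ∀ᶠ N : ℕ in Filter.atTop, ∃ δ : ENNReal, 0 < δ ∧ ∀ Ψ : Literature.MathematicalPhysics.QuantumManyBody.BoseGas.PeriodicTrialState N (Literature.MathematicalPhysics.QuantumManyBody.BoseGas.sideLength ρ N), Literature.MathematicalPhysics.QuantumManyBody.BoseGas.periodicEnergy v Ψ ≤ Literature.MathematicalPhysics.QuantumManyBody.BoseGas.periodicGroundStateEnergy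 v N (Literature.MathematicalPhysics.QuantumManyBody.BoseGas.sideLength ρ N) + δ → ∀ m : Fin 3 → ℤ, m ≠ 0 → (∀ j : Fin 3, |((m j : ℤ) : ℝ)| ≤ κ * Real.sqrt ρ * Literature.MathematicalPhysics.QuantumManyBody.BoseGas.sideLength ρ N) → Literature.MathematicalPhysics.QuantumManyBody.BoseGas.structureFactorVar N (Literature.MathematicalPhysics.QuantumManyBody.BoseGas.sideLength ρ N) ((Literature.MathematicalPhysics.QuantumManyBody.BoseGas.cellN N (Literature.MathematicalPhysics.QuantumManyBody.BoseGas.sideLength ρ N)).indicator Ψ.ψ) m ≤ ENNReal.ofReal σ * (N : ENNReal))) :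
    (∀ v : ℝ → ENNReal, Literature.MathematicalPhysics.QuantumManyBody.BoseGas.IsRepulsiveFiniteRange v → ∃ κ : ℝ, 0 < κ ∧ ∃ σ : ℝ, 0 < σ ∧ ∃ ρ₀ : ℝ, 0 < ρ₀ ∧ ∀ ρ : ℝ, 0 < ρ → ρ < ρ₀ → ∀ᶠ N : ℕ in Filter.atTop, ∃ δ : ENNReal, 0 < δ ∧ ∀ Ψ : Literature.MathematicalPhysics.QuantumManyBody.BoseGas.PeriodicTrialState N (Literature.MathematicalPhysics.QuantumManyBody.BoseGas.sideLength ρ N), Literature.MathematicalPhysics.QuantumManyBody.BoseGas.periodicEnergy v Ψ ≤ Literature.MathematicalPhysics.QuantumManyBody.BoseGas.periodicGroundStateEnergy v N (Literature.MathematicalPhysics.QuantumManyBody.BoseGas.sideLength ρ N) + δ → ∀ m : Fin 3 → ℤ, m ≠ 0 → (∀ j : Fin 3, |((m j : ℤ) : ℝ)| ≤ κ * Real.sqrt ρ * Literature.MathematicalPhysics.QuantumManyBody.BoseGas.sideLength ρ N) → Literature.MathematicalPhysics.QuantumManyBody.BoseGas.structureFactorVar N (Literature.MathematicalPhysics.QuantumManyBody.BoseGas.sideLength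 ρ N) ((Literature.MathematicalPhysics.QuantumManyBody.BoseGas.cellN N (Literature.MathematicalPhysics.QuantumManyBody.BoseGas.sideLength ρ N)).indicator Ψ.ψ) m ≤ ENNReal.ofReal σ * (N : ENNReal)) := by
  intro v hv
  rcases (ENNReal.toReal_nonneg : 0 ≤ (Literature.MathematicalPhysics.QuantumManyBody.BoseGas.scatteringLength v).toReal).eq_or_lt with h0 | hpos
  · have ha : Literature.MathematicalPhysics.QuantumManyBody.BoseGas.scatteringLength v = 0 := by
      rcases (ENNReal.toReal_eq_zero_iff _).1 h0.symm with h | h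
      · exact h
      · exact absurd h hv.scatteringLength_ne_top
    exact hF v hv ha
  · exact hP v hv hpos

/-! ## §5 (g24) The structure factor of a cell-restricted state is the cell-restricted infimum -/

open MeasureTheory in
/-- The structure factor of the cell-restricted state `1_cell·ψ` equals the cell-restricted infimum form (`lintegral_indicator`). [folklore] -/
theorem structureFactorVar_indicator_cellN (N : ℕ) (L : ℝ) (ψ : (Fin N → EuclideanSpace ℝ (Fin 3)) → ℂ) (m : Fin 3 → ℤ) :
    Literature.MathematicalPhysics.QuantumManyBody.BoseGas.structureFactorVar N L ((Literature.MathematicalPhysics.QuantumManyBody.BoseGas.cellN N L).indicator ψ) m =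
      ⨅ c : ℂ, ∫⁻ X in Literature.MathematicalPhysics.QuantumManyBody.BoseGas.cellN N L,
        (‖Literature.MathematicalPhysics.QuantumManyBody.BoseGas.densityWave N L m X - c‖₊ : ENNReal) ^ 2 * (‖ψ X‖₊ : ENNReal) ^ 2 := by
  rw [Literature.MathematicalPhysics.QuantumManyBody.BoseGas.structureFactorVar_eq_iInf]
  refine iInf_congr fun c => ?_
  rw [← lintegral_indicator (Literature.MathematicalPhysics.QuantumManyBody.BoseGas.measurableSet_cellN N L)]
  refine lintegral_congr fun X => ?_
  by_cases hX : X ∈ Literature.MathematicalPhysics.QuantumManyBody.BoseGas.cellN N L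
  · simp [Set.indicator_of_mem hX]
  · simp [hX]

/-! ## §6 (g24) PIECE A (a > 0) FROM THE SHARED CRUX stmt-AtomisticToContinuum-9093, BY NAME (real proof) -/

/-- **PIECE A (a > 0) ⟸ the SHARED crux `BECSectorPoincareTwoScale.TorusHyperuniformity` (stmt-AtomisticToContinuum-9093) BY NAME** (real proof:
`M₀ = 1`, `L = sideLength ρ N`, window constant `κ := √a/(2π√3)` so that `|m_j| ≤ κ√ρ·L ⇒ |k| ≤ √(ρa)`, `σ := C`). [folklore] -/
theorem deepDensityFlatnessPos_of_torusHyperuniformity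
    (hTH : Summit.AtomisticToContinuum.BoseEinsteinCondensation.Theses.BECSectorPoincareTwoScale.TorusHyperuniformity) :
    (∀ v : ℝ → ENNReal, Literature.MathematicalPhysics.QuantumManyBody.BoseGas.IsRepulsiveFiniteRange v → 0 < (Literature.MathematicalPhysics.QuantumManyBody.BoseGas.scatteringLength v).toReal → ∃ κ : ℝ, 0 < κ ∧ ∃ σ : ℝ, 0 < σ ∧ ∃ ρ₀ : ℝ, 0 < ρ₀ ∧ ∀ ρ : ℝ, 0 < ρ → ρ < ρ₀ → ∀ᶠ N : ℕ in Filter.atTop, ∃ δ : ENNReal, 0 < δ ∧ ∀ Ψ : Literature.MathematicalPhysics.QuantumManyBody.BoseGas.PeriodicTrialState N (Literature.MathematicalPhysics.QuantumManyBody.BoseGas.sideLength ρ N), Literature.MathematicalPhysics.QuantumManyBody.BoseGas.periodicEnergy v Ψ ≤ Literature.MathematicalPhysics.QuantumManyBody.BoseGas.periodicGroundStateEnergy v N (Literature.MathematicalPhysics.QuantumManyBody.BoseGas.sideLength ρ N) + δ → ∀ m : Fin 3 → ℤ, m ≠ 0 → (∀ j : Fin 3, |((m j : ℤ) : ℝ)|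 ≤ κ * Real.sqrt ρ * Literature.MathematicalPhysics.QuantumManyBody.BoseGas.sideLength ρ N) → Literature.MathematicalPhysics.QuantumManyBody.BoseGas.structureFactorVar N (Literature.MathematicalPhysics.QuantumManyBody.BoseGas.sideLength ρ N) ((Literature.MathematicalPhysics.QuantumManyBody.BoseGas.cellN N (Literature.MathematicalPhysics.QuantumManyBody.BoseGas.sideLength ρ N)).indicator Ψ.ψ) m ≤ ENNReal.ofReal σ * (N : ENNReal)) := by
  intro v hv ha
  set a : ℝ := (Literature.MathematicalPhysics.QuantumManyBody.BoseGas.scatteringLength v).toReal with ha_def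
  obtain ⟨C, hC, ρ₀, hρ₀, H⟩ := hTH v hv 1 one_pos
  have hs3 : (0 : ℝ) < Real.sqrt 3 := Real.sqrt_pos.2 (by norm_num)
  refine ⟨Real.sqrt a / (2 * Real.pi * Real.sqrt 3), by positivity, C, hC, ρ₀, hρ₀, fun ρ hρ hρlt => ?_⟩
  filter_upwards [H ρ hρ hρlt, Filter.eventually_gt_atTop 0] with N hN hNpos
  set L : ℝ := Literature.MathematicalPhysics.QuantumManyBody.BoseGas.sideLength ρ N with hL_def
  have hNr : (0 : ℝ) < (N : ℝ) := Nat.cast_pos.2 hNpos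
  have hL : 0 < L := Real.rpow_pos_of_pos (div_pos hNr hρ) _
  have hL3 : L ^ 3 = (N : ℝ) / ρ :=
    Literature.MathematicalPhysics.QuantumManyBody.BoseGas.sideLength_pow_three hρ N
  have hdens : (N : ℝ) / L ^ 3 = ρ := by
    rw [hL3]
    field_simp
  have hw1 : ρ / 2 ≤ (N : ℝ) / L ^ 3 := by rw [hdens]; linarith
  have hw2 : (N : ℝ) / L ^ 3 ≤ 2 * ρ := by rw [hdens]; linarith
  obtain ⟨δ, hδ, HΨ⟩ := hN L hL hw1 hw2
  refine ⟨δ, hδ, fun Ψ hE m hm hwin => ?_⟩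
  have h := HΨ Ψ hE m hm
  dsimp only at h
  -- the deep window sits inside the wavevector window `|k| ≤ √(ρa)`
  set B : ℝ := Real.sqrt a / (2 * Real.pi * Real.sqrt 3) * Real.sqrt ρ * L with hB_def
  have hB : 0 ≤ B := by positivity
  have hnorm : ‖(WithLp.toLp 2 fun t => (m t : ℝ) : EuclideanSpace ℝ (Fin 3))‖ ≤ Real.sqrt 3 * B := by
    rw [EuclideanSpace.norm_eq]
    have hsum : ∑ t : Fin 3, ‖(WithLp.toLp 2 fun t => (m t : ℝ) : EuclideanSpace ℝ (Fin 3)) t‖ ^ 2 ≤ 3 * B ^ 2 := by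
      have hterm : ∀ t : Fin 3, ‖(WithLp.toLp 2 fun t => (m t : ℝ) : EuclideanSpace ℝ (Fin 3)) t‖ ^ 2 ≤ B ^ 2 := by
        intro t
        have h1 : ‖(WithLp.toLp 2 fun t => (m t : ℝ) : EuclideanSpace ℝ (Fin 3)) t‖ = |((m t : ℤ) : ℝ)| := by
          simp [Real.norm_eq_abs]
        rw [h1]
        exact pow_le_pow_left₀ (abs_nonneg _) (hwin t) 2
      calc ∑ t : Fin 3, ‖(WithLp.toLp 2 fun t => (m t : ℝ) : EuclideanSpace ℝ (Fin 3)) t‖ ^ 2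
          ≤ ∑ _t : Fin 3, B ^ 2 := Finset.sum_le_sum fun t _ => hterm t
        _ = 3 * B ^ 2 := by simp
    calc Real.sqrt (∑ t : Fin 3, ‖(WithLp.toLp 2 fun t => (m t : ℝ) : EuclideanSpace ℝ (Fin 3)) t‖ ^ 2)
        ≤ Real.sqrt (3 * B ^ 2) := Real.sqrt_le_sqrt hsum
      _ = Real.sqrt 3 * B := by rw [Real.sqrt_mul (by norm_num), Real.sqrt_sq hB]
  have hk : 2 * Real.pi / L * ‖(WithLp.toLp 2 fun t => (m t : ℝ) : EuclideanSpace ℝ (Fin 3))‖ ≤ 1 * Real.sqrt (ρ * a) := by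
    calc 2 * Real.pi / L * ‖(WithLp.toLp 2 fun t => (m t : ℝ) : EuclideanSpace ℝ (Fin 3))‖
        ≤ 2 * Real.pi / L * (Real.sqrt 3 * B) := mul_le_mul_of_nonneg_left hnorm (by positivity)
      _ = Real.sqrt ρ * Real.sqrt a := by
          rw [hB_def]
          field_simp
      _ = 1 * Real.sqrt (ρ * a) := by rw [Real.sqrt_mul hρ.le, one_mul]
  have hb := h hk
  have hsa : 0 < Real.sqrt (ρ * a) := Real.sqrt_pos.2 (mul_pos hρ ha)
  have hreal : C * N * (2 * Real.pi / L * ‖(WithLp.toLp 2 fun t => (m t : ℝ) : EuclideanSpace ℝ (Fin 3))‖) / Real.sqrt (ρ * a) ≤ C * N := by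
    rw [div_le_iff₀ hsa]
    rw [one_mul] at hk
    exact mul_le_mul_of_nonneg_left hk (by positivity)
  rw [structureFactorVar_indicator_cellN]
  calc (⨅ c : ℂ, ∫⁻ X in Literature.MathematicalPhysics.QuantumManyBody.BoseGas.cellN N L,
        (‖Literature.MathematicalPhysics.QuantumManyBody.BoseGas.densityWave N L m X - c‖₊ : ENNReal) ^ 2 * (‖Ψ.ψ X‖₊ : ENNReal) ^ 2)
      ≤ ENNReal.ofReal (C * N * (2 * Real.pi / L * ‖(WithLp.toLp 2 fun t => (m t : ℝ) : EuclideanSpace ℝ (Fin 3))‖) / Real.sqrt (ρ * a)) := hb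
    _ ≤ ENNReal.ofReal (C * N) := ENNReal.ofReal_le_ofReal hreal
    _ = ENNReal.ofReal C * (N : ENNReal) := by rw [ENNReal.ofReal_mul hC.le, ENNReal.ofReal_natCast]

/-- A from the shared crux and the free leaf. -/
theorem deepDensityFlatness_of_torusHyperuniformity_free
    (hTH : Summit.AtomisticToContinuum.BoseEinsteinCondensation.Theses.BECSectorPoincareTwoScale.TorusHyperuniformity)
    (hF : (∀ v : ℝ → ENNReal, Literature.MathematicalPhysics.QuantumManyBody.BoseGas.IsRepulsiveFiniteRange v → Literature.MathematicalPhysics.QuantumManyBody.BoseGas.scatteringLength v = 0 → ∃ κ : ℝ, 0 < κ ∧ ∃ σ : ℝ, 0 < σ ∧ ∃ ρ₀ : ℝ, 0 < ρ₀ ∧ ∀ ρ : ℝ, 0 < ρ → ρ < ρ₀ → ∀ᶠ N : ℕ in Filter.atTop, ∃ δ : ENNReal, 0 < δ ∧ ∀ Ψ : Literature.MathematicalPhysics.QuantumManyBody.BoseGas.PeriodicTrialState N (Literature.MathematicalPhysics.QuantumManyBody.BoseGas.sideLength ρ N), Literature.MathematicalPhysics.QuantumManyBody.BoseGas.periodicEnergy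 v Ψ ≤ Literature.MathematicalPhysics.QuantumManyBody.BoseGas.periodicGroundStateEnergy v N (Literature.MathematicalPhysics.QuantumManyBody.BoseGas.sideLength ρ N) + δ → ∀ m : Fin 3 → ℤ, m ≠ 0 → (∀ j : Fin 3, |((m j : ℤ) : ℝ)| ≤ κ * Real.sqrt ρ * Literature.MathematicalPhysics.QuantumManyBody.BoseGas.sideLength ρ N) → Literature.MathematicalPhysics.QuantumManyBody.BoseGas.structureFactorVar N (Literature.MathematicalPhysics.QuantumManyBody.BoseGas.sideLength ρ N) ((Literature.MathematicalPhysics.QuantumManyBody.BoseGas.cellN N (Literature.MathematicalPhysics.QuantumManyBody.BoseGas.sideLength ρ N)).indicator Ψ.ψ) m ≤ ENNReal.ofReal σ * (N : ENNReal))) : (∀ v : ℝ → ENNReal, Literature.MathematicalPhysics.QuantumManyBody.BoseGas.IsRepulsiveFiniteRange v → ∃ κ : ℝ, 0 < κ ∧ ∃ σ : ℝ, 0 < σ ∧ ∃ ρ₀ : ℝ, 0 < ρ₀ ∧ ∀ ρ : ℝ, 0 < ρ → ρ < ρ₀ → ∀ᶠ N : ℕ in Filter.atTop, ∃ δ : ENNReal,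 0 < δ ∧ ∀ Ψ : Literature.MathematicalPhysics.QuantumManyBody.BoseGas.PeriodicTrialState N (Literature.MathematicalPhysics.QuantumManyBody.BoseGas.sideLength ρ N), Literature.MathematicalPhysics.QuantumManyBody.BoseGas.periodicEnergy v Ψ ≤ Literature.MathematicalPhysics.QuantumManyBody.BoseGas.periodicGroundStateEnergy v N (Literature.MathematicalPhysics.QuantumManyBody.BoseGas.sideLength ρ N) + δ → ∀ m : Fin 3 → ℤ, m ≠ 0 → (∀ j : Fin 3, |((m j : ℤ) : ℝ)| ≤ κ * Real.sqrt ρ * Literature.MathematicalPhysics.QuantumManyBody.BoseGas.sideLength ρ N) → Literature.MathematicalPhysics.QuantumManyBody.BoseGas.structureFactorVar N (Literature.MathematicalPhysics.QuantumManyBody.BoseGas.sideLength ρ N) ((Literature.MathematicalPhysics.QuantumManyBody.BoseGas.cellN N (Literature.MathematicalPhysics.QuantumManyBody.BoseGas.sideLength ρ N)).indicator Ψ.ψ) m ≤ ENNReal.ofReal σ * (N : ENNReal)) :=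
  deepDensityFlatness_of_pos_free (deepDensityFlatnessPos_of_torusHyperuniformity hTH) hF

/-! ## §8 (g24) THE NODE, BY NAME -/

/-- `TorusHyperuniformity (9093, shared open crux) → (∀ v : ℝ → ENNReal, Literature.MathematicalPhysics.QuantumManyBody.BoseGas.IsRepulsiveFiniteRange v → Literature.MathematicalPhysics.QuantumManyBody.BoseGas.scatteringLength v = 0 → ∃ κ : ℝ, 0 < κ ∧ ∃ σ : ℝ, 0 < σ ∧ ∃ ρ₀ : ℝ, 0 < ρ₀ ∧ ∀ ρ : ℝ, 0 < ρ → ρ < ρ₀ → ∀ᶠ N : ℕ in Filter.atTop, ∃ δ : ENNReal, 0 < δ ∧ ∀ Ψ : Literature.MathematicalPhysics.QuantumManyBody.BoseGas.PeriodicTrialState N (Literature.MathematicalPhysics.QuantumManyBody.BoseGas.sideLength ρ N), Literature.MathematicalPhysics.QuantumManyBody.BoseGas.periodicEnergy v Ψ ≤ Literature.MathematicalPhysics.QuantumManyBody.BoseGas.periodicGroundStateEnergy v N (Literature.MathematicalPhysics.QuantumManyBody.BoseGas.sideLength ρ N) + δ → ∀ m : Fin 3 → ℤ, m ≠ 0 →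 (∀ j : Fin 3, |((m j : ℤ) : ℝ)| ≤ κ * Real.sqrt ρ * Literature.MathematicalPhysics.QuantumManyBody.BoseGas.sideLength ρ N) → Literature.MathematicalPhysics.QuantumManyBody.BoseGas.structureFactorVar N (Literature.MathematicalPhysics.QuantumManyBody.BoseGas.sideLength ρ N) ((Literature.MathematicalPhysics.QuantumManyBody.BoseGas.cellN N (Literature.MathematicalPhysics.QuantumManyBody.BoseGas.sideLength ρ N)).indicator Ψ.ψ) m ≤ ENNReal.ofReal σ * (N : ENNReal)) (support, a = 0) → (∀ v : ℝ → ENNReal, Literature.MathematicalPhysics.QuantumManyBody.BoseGas.IsRepulsiveFiniteRange v → ∃ A : ℝ, 0 < A ∧ ∃ θ : ℝ, 0 < θ ∧ ∃ C : ℝ, 0 < C ∧ ∃ ρ₀ : ℝ, 0 < ρ₀ ∧ ∀ ρ : ℝ, 0 < ρ → ρ < ρ₀ → ∀ᶠ N : ℕ in Filter.atTop, ∃ δ : ENNReal, 0 < δ ∧ ∀ Ψ : Literature.MathematicalPhysics.QuantumManyBody.BoseGas.PeriodicTrialState N (Literature.MathematicalPhysics.QuantumManyBody.BoseGas.sideLength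 ρ N), Literature.MathematicalPhysics.QuantumManyBody.BoseGas.periodicEnergy v Ψ ≤ Literature.MathematicalPhysics.QuantumManyBody.BoseGas.periodicGroundStateEnergy v N (Literature.MathematicalPhysics.QuantumManyBody.BoseGas.sideLength ρ N) + δ → ∀ K : ℕ, Even K → 0 < K → A / Real.sqrt ρ ≤ Literature.MathematicalPhysics.QuantumManyBody.BoseGas.sideLength ρ N / (K : ℝ) ∧ Literature.MathematicalPhysics.QuantumManyBody.BoseGas.sideLength ρ N / (K : ℝ) ≤ 2 * A / Real.sqrt ρ → ∀ q ∈ (Finset.univ.filter fun q : Fin 3 → Fin K => ¬ (∀ j : Fin 3, (q j : ℕ) = 0) ∧ (∑ j : Fin 3, (1 - Real.cos (2 * Real.pi * ((q j : ℕ) : ℝ) / (K : ℝ)))) < θ), Literature.MathematicalPhysics.QuantumManyBody.BoseGas.cellOccupation N (Literature.MathematicalPhysics.QuantumManyBody.BoseGas.sideLength ρ N) (fun x : EuclideanSpace ℝ (Fin 3) => (((Real.sqrt (Literature.MathematicalPhysics.QuantumManyBody.BoseGas.sideLength ρ N ^ 3))⁻¹ : ℝ) : ℂ) * Complex.exp (((2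 * Real.pi * (∑ j : Fin 3, ((q j : ℕ) : ℝ) * (⌊(K : ℝ) * x j / Literature.MathematicalPhysics.QuantumManyBody.BoseGas.sideLength ρ N⌋ : ℝ)) / (K : ℝ) : ℝ) : ℂ) * Complex.I)) Ψ.ψ ≤ ENNReal.ofReal (C / (∑ j : Fin 3, (1 - Real.cos (2 * Real.pi * ((q j : ℕ) : ℝ) / (K : ℝ))))) * (1 + Literature.MathematicalPhysics.QuantumManyBody.BoseGas.structureFactorVar N (Literature.MathematicalPhysics.QuantumManyBody.BoseGas.sideLength ρ N) ((Literature.MathematicalPhysics.QuantumManyBody.BoseGas.cellN N (Literature.MathematicalPhysics.QuantumManyBody.BoseGas.sideLength ρ N)).indicator Ψ.ψ) (fun j : Fin 3 => if 2 * (q j : ℕ) ≤ K then (((q j : ℕ) : ℤ)) else (((q j : ℕ) : ℤ) - (K : ℤ))) / (N : ENNReal))) (residual B)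
→ BlockLatticeFSum.DeepInfraredEmptiness` (route decl, stmt-27506). -/
theorem deepInfraredEmptiness_of_torusHyperuniformity_free_gain
    (hTH : Summit.AtomisticToContinuum.BoseEinsteinCondensation.Theses.BECSectorPoincareTwoScale.TorusHyperuniformity)
    (hF : (∀ v : ℝ → ENNReal, Literature.MathematicalPhysics.QuantumManyBody.BoseGas.IsRepulsiveFiniteRange v → Literature.MathematicalPhysics.QuantumManyBody.BoseGas.scatteringLength v = 0 → ∃ κ : ℝ, 0 < κ ∧ ∃ σ : ℝ, 0 < σ ∧ ∃ ρ₀ : ℝ, 0 < ρ₀ ∧ ∀ ρ : ℝ, 0 < ρ → ρ < ρ₀ → ∀ᶠ N : ℕ in Filter.atTop, ∃ δ : ENNReal, 0 < δ ∧ ∀ Ψ : Literature.MathematicalPhysics.QuantumManyBody.BoseGas.PeriodicTrialState N (Literature.MathematicalPhysics.QuantumManyBody.BoseGas.sideLength ρ N), Literature.MathematicalPhysics.QuantumManyBody.BoseGas.periodicEnergy v Ψ ≤ Literature.MathematicalPhysics.QuantumManyBody.BoseGas.periodicGroundStateEnergy v N (Literature.MathematicalPhysics.QuantumManyBody.BoseGas.sideLength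 ρ N) + δ → ∀ m : Fin 3 → ℤ, m ≠ 0 → (∀ j : Fin 3, |((m j : ℤ) : ℝ)| ≤ κ * Real.sqrt ρ * Literature.MathematicalPhysics.QuantumManyBody.BoseGas.sideLength ρ N) → Literature.MathematicalPhysics.QuantumManyBody.BoseGas.structureFactorVar N (Literature.MathematicalPhysics.QuantumManyBody.BoseGas.sideLength ρ N) ((Literature.MathematicalPhysics.QuantumManyBody.BoseGas.cellN N (Literature.MathematicalPhysics.QuantumManyBody.BoseGas.sideLength ρ N)).indicator Ψ.ψ) m ≤ ENNReal.ofReal σ * (N : ENNReal))) (hB : (∀ v : ℝ → ENNReal, Literature.MathematicalPhysics.QuantumManyBody.BoseGas.IsRepulsiveFiniteRange v → ∃ A : ℝ, 0 < A ∧ ∃ θ : ℝ, 0 < θ ∧ ∃ C : ℝ, 0 < C ∧ ∃ ρ₀ : ℝ, 0 < ρ₀ ∧ ∀ ρ : ℝ, 0 < ρ → ρ < ρ₀ → ∀ᶠ N : ℕ in Filter.atTop, ∃ δ : ENNReal, 0 < δ ∧ ∀ Ψ : Literature.MathematicalPhysics.QuantumManyBody.BoseGas.PeriodicTrialState N (Literature.MathematicalPhysics.QuantumManyBody.BoseGas.sideLength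 ρ N), Literature.MathematicalPhysics.QuantumManyBody.BoseGas.periodicEnergy v Ψ ≤ Literature.MathematicalPhysics.QuantumManyBody.BoseGas.periodicGroundStateEnergy v N (Literature.MathematicalPhysics.QuantumManyBody.BoseGas.sideLength ρ N) + δ → ∀ K : ℕ, Even K → 0 < K → A / Real.sqrt ρ ≤ Literature.MathematicalPhysics.QuantumManyBody.BoseGas.sideLength ρ N / (K : ℝ) ∧ Literature.MathematicalPhysics.QuantumManyBody.BoseGas.sideLength ρ N / (K : ℝ) ≤ 2 * A / Real.sqrt ρ → ∀ q ∈ (Finset.univ.filter fun q : Fin 3 → Fin K => ¬ (∀ j : Fin 3, (q j : ℕ) = 0) ∧ (∑ j : Fin 3, (1 - Real.cos (2 * Real.pi * ((q j : ℕ) : ℝ) / (K : ℝ)))) < θ), Literature.MathematicalPhysics.QuantumManyBody.BoseGas.cellOccupation N (Literature.MathematicalPhysics.QuantumManyBody.BoseGas.sideLength ρ N) (fun x : EuclideanSpace ℝ (Fin 3) => (((Real.sqrt (Literature.MathematicalPhysics.QuantumManyBody.BoseGas.sideLength ρ N ^ 3))⁻¹ : ℝ) : ℂ) * Complex.exp (((2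 * Real.pi * (∑ j : Fin 3, ((q j : ℕ) : ℝ) * (⌊(K : ℝ) * x j / Literature.MathematicalPhysics.QuantumManyBody.BoseGas.sideLength ρ N⌋ : ℝ)) / (K : ℝ) : ℝ) : ℂ) * Complex.I)) Ψ.ψ ≤ ENNReal.ofReal (C / (∑ j : Fin 3, (1 - Real.cos (2 * Real.pi * ((q j : ℕ) : ℝ) / (K : ℝ))))) * (1 + Literature.MathematicalPhysics.QuantumManyBody.BoseGas.structureFactorVar N (Literature.MathematicalPhysics.QuantumManyBody.BoseGas.sideLength ρ N) ((Literature.MathematicalPhysics.QuantumManyBody.BoseGas.cellN N (Literature.MathematicalPhysics.QuantumManyBody.BoseGas.sideLength ρ N)).indicator Ψ.ψ) (fun j : Fin 3 => if 2 * (q j : ℕ) ≤ K then (((q j : ℕ) : ℤ)) else (((q j : ℕ) : ℤ) - (K : ℤ))) / (N : ENNReal)))) :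
    Summit.AtomisticToContinuum.BoseEinsteinCondensation.Theses.BlockLatticeFSum.DeepInfraredEmptiness :=
  deepInfraredEmptiness_of_flatness_gain (deepDensityFlatness_of_torusHyperuniformity_free hTH hF) hB

/-- the core stub of the registered weak skeleton, from the same inputs. -/
theorem deepPointwiseOne_of_torusHyperuniformity_free_gain
    (hTH : Summit.AtomisticToContinuum.BoseEinsteinCondensation.Theses.BECSectorPoincareTwoScale.TorusHyperuniformity)
    (hF : (∀ v : ℝ → ENNReal, Literature.MathematicalPhysics.QuantumManyBody.BoseGas.IsRepulsiveFiniteRange v → Literature.MathematicalPhysics.QuantumManyBody.BoseGas.scatteringLength v = 0 → ∃ κ : ℝ, 0 < κ ∧ ∃ σ : ℝ, 0 < σ ∧ ∃ ρ₀ : ℝ, 0 < ρ₀ ∧ ∀ ρ : ℝ, 0 < ρ → ρ < ρ₀ → ∀ᶠ N : ℕ in Filter.atTop, ∃ δ : ENNReal, 0 < δ ∧ ∀ Ψ : Literature.MathematicalPhysics.QuantumManyBody.BoseGas.PeriodicTrialState N (Literature.MathematicalPhysics.QuantumManyBody.BoseGas.sideLength ρ N), Literature.MathematicalPhysics.QuantumManyBody.BoseGas.periodicEnergy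 v Ψ ≤ Literature.MathematicalPhysics.QuantumManyBody.BoseGas.periodicGroundStateEnergy v N (Literature.MathematicalPhysics.QuantumManyBody.BoseGas.sideLength ρ N) + δ → ∀ m : Fin 3 → ℤ, m ≠ 0 → (∀ j : Fin 3, |((m j : ℤ) : ℝ)| ≤ κ * Real.sqrt ρ * Literature.MathematicalPhysics.QuantumManyBody.BoseGas.sideLength ρ N) → Literature.MathematicalPhysics.QuantumManyBody.BoseGas.structureFactorVar N (Literature.MathematicalPhysics.QuantumManyBody.BoseGas.sideLength ρ N) ((Literature.MathematicalPhysics.QuantumManyBody.BoseGas.cellN N (Literature.MathematicalPhysics.QuantumManyBody.BoseGas.sideLength ρ N)).indicator Ψ.ψ) m ≤ ENNReal.ofReal σ * (N : ENNReal))) (hB : (∀ v : ℝ → ENNReal, Literature.MathematicalPhysics.QuantumManyBody.BoseGas.IsRepulsiveFiniteRange v → ∃ A : ℝ, 0 < A ∧ ∃ θ : ℝ, 0 < θ ∧ ∃ C : ℝ, 0 < C ∧ ∃ ρ₀ : ℝ, 0 < ρ₀ ∧ ∀ ρ : ℝ, 0 < ρ → ρ < ρ₀ → ∀ᶠ N :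 ℕ in Filter.atTop, ∃ δ : ENNReal, 0 < δ ∧ ∀ Ψ : Literature.MathematicalPhysics.QuantumManyBody.BoseGas.PeriodicTrialState N (Literature.MathematicalPhysics.QuantumManyBody.BoseGas.sideLength ρ N), Literature.MathematicalPhysics.QuantumManyBody.BoseGas.periodicEnergy v Ψ ≤ Literature.MathematicalPhysics.QuantumManyBody.BoseGas.periodicGroundStateEnergy v N (Literature.MathematicalPhysics.QuantumManyBody.BoseGas.sideLength ρ N) + δ → ∀ K : ℕ, Even K → 0 < K → A / Real.sqrt ρ ≤ Literature.MathematicalPhysics.QuantumManyBody.BoseGas.sideLength ρ N / (K : ℝ) ∧ Literature.MathematicalPhysics.QuantumManyBody.BoseGas.sideLength ρ N / (K : ℝ) ≤ 2 * A / Real.sqrt ρ → ∀ q ∈ (Finset.univ.filter fun q : Fin 3 → Fin K => ¬ (∀ j : Fin 3, (q j : ℕ) = 0) ∧ (∑ j : Fin 3, (1 - Real.cos (2 * Real.pi * ((q j : ℕ) : ℝ) / (K : ℝ)))) < θ), Literature.MathematicalPhysics.QuantumManyBody.BoseGas.cellOccupation N (Literature.MathematicalPhysics.QuantumManyBody.BoseGas.sideLength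 ρ N) (fun x : EuclideanSpace ℝ (Fin 3) => (((Real.sqrt (Literature.MathematicalPhysics.QuantumManyBody.BoseGas.sideLength ρ N ^ 3))⁻¹ : ℝ) : ℂ) * Complex.exp (((2 * Real.pi * (∑ j : Fin 3, ((q j : ℕ) : ℝ) * (⌊(K : ℝ) * x j / Literature.MathematicalPhysics.QuantumManyBody.BoseGas.sideLength ρ N⌋ : ℝ)) / (K : ℝ) : ℝ) : ℂ) * Complex.I)) Ψ.ψ ≤ ENNReal.ofReal (C / (∑ j : Fin 3, (1 - Real.cos (2 * Real.pi * ((q j : ℕ) : ℝ) / (K : ℝ))))) * (1 + Literature.MathematicalPhysics.QuantumManyBody.BoseGas.structureFactorVar N (Literature.MathematicalPhysics.QuantumManyBody.BoseGas.sideLength ρ N) ((Literature.MathematicalPhysics.QuantumManyBody.BoseGas.cellN N (Literature.MathematicalPhysics.QuantumManyBody.BoseGas.sideLength ρ N)).indicator Ψ.ψ) (fun j : Fin 3 => if 2 * (q j : ℕ) ≤ K then (((q j : ℕ) : ℤ)) else (((q j : ℕ) : ℤ) - (K : ℤ))) / (N : ENNReal)))) : (∀ v : ℝ → ENNReal, Literature.MathematicalPhysics.QuantumManyBody.BoseGas.IsRepulsiveFiniteRange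 v → ∃ A : ℝ, 0 < A ∧ ∃ θ : ℝ, 0 < θ ∧ ∃ C : ℝ, 0 < C ∧ ∃ ρ₀ : ℝ, 0 < ρ₀ ∧ ∀ ρ : ℝ, 0 < ρ → ρ < ρ₀ → ∀ᶠ N : ℕ in Filter.atTop, ∃ δ : ENNReal, 0 < δ ∧ ∀ Ψ : Literature.MathematicalPhysics.QuantumManyBody.BoseGas.PeriodicTrialState N (Literature.MathematicalPhysics.QuantumManyBody.BoseGas.sideLength ρ N), Literature.MathematicalPhysics.QuantumManyBody.BoseGas.periodicEnergy v Ψ ≤ Literature.MathematicalPhysics.QuantumManyBody.BoseGas.periodicGroundStateEnergy v N (Literature.MathematicalPhysics.QuantumManyBody.BoseGas.sideLength ρ N) + δ → ∀ K : ℕ, Even K → 0 < K → A / Real.sqrt ρ ≤ Literature.MathematicalPhysics.QuantumManyBody.BoseGas.sideLength ρ N / (K : ℝ) ∧ Literature.MathematicalPhysics.QuantumManyBody.BoseGas.sideLength ρ N / (K : ℝ) ≤ 2 * A / Real.sqrt ρ → ∀ q ∈ (Finset.univ.filter fun q : Fin 3 → Fin K => ¬ (∀ j : Fin 3, (q j :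 ℕ) = 0) ∧ (∑ j : Fin 3, (1 - Real.cos (2 * Real.pi * ((q j : ℕ) : ℝ) / (K : ℝ)))) < θ), Literature.MathematicalPhysics.QuantumManyBody.BoseGas.cellOccupation N (Literature.MathematicalPhysics.QuantumManyBody.BoseGas.sideLength ρ N) (fun x : EuclideanSpace ℝ (Fin 3) => (((Real.sqrt (Literature.MathematicalPhysics.QuantumManyBody.BoseGas.sideLength ρ N ^ 3))⁻¹ : ℝ) : ℂ) * Complex.exp (((2 * Real.pi * (∑ j : Fin 3, ((q j : ℕ) : ℝ) * (⌊(K : ℝ) * x j / Literature.MathematicalPhysics.QuantumManyBody.BoseGas.sideLength ρ N⌋ : ℝ)) / (K : ℝ) : ℝ) : ℂ) * Complex.I)) Ψ.ψ ≤ ENNReal.ofReal (C / (∑ j : Fin 3, (1 - Real.cos (2 * Real.pi * ((q j : ℕ) : ℝ) / (K : ℝ)))))) :=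
  deepPointwiseOne_of_flatness_gain (deepDensityFlatness_of_torusHyperuniformity_free hTH hF) hB



/-! ## §10 (g24) THE NODE OF RECORD, BY NAME: `DeepInfraredEmptiness ⟸ TorusHyperuniformity (9093, shared, open) ∧ (∀ v : ℝ → ENNReal, Literature.MathematicalPhysics.QuantumManyBody.BoseGas.IsRepulsiveFiniteRange v → ∃ A : ℝ, 0 < A ∧ ∃ θ : ℝ, 0 < θ ∧ ∃ C : ℝ, 0 < C ∧ ∃ ρ₀ : ℝ, 0 < ρ₀ ∧ ∀ ρ : ℝ, 0 < ρ → ρ < ρ₀ → ∀ᶠ N : ℕ in Filter.atTop, ∃ δ : ENNReal, 0 < δ ∧ ∀ Ψ : Literature.MathematicalPhysics.QuantumManyBody.BoseGas.PeriodicTrialState N (Literature.MathematicalPhysics.QuantumManyBody.BoseGas.sideLength ρ N), Literature.MathematicalPhysics.QuantumManyBody.BoseGas.periodicEnergy v Ψ ≤ Literature.MathematicalPhysics.QuantumManyBody.BoseGas.periodicGroundStateEnergy v N (Literature.MathematicalPhysics.QuantumManyBody.BoseGas.sideLength ρ N) + δ → ∀ K : ℕ, Even K → 0 < K → A / Real.sqrt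 ρ ≤ Literature.MathematicalPhysics.QuantumManyBody.BoseGas.sideLength ρ N / (K : ℝ) ∧ Literature.MathematicalPhysics.QuantumManyBody.BoseGas.sideLength ρ N / (K : ℝ) ≤ 2 * A / Real.sqrt ρ → ∀ q ∈ (Finset.univ.filter fun q : Fin 3 → Fin K => ¬ (∀ j : Fin 3, (q j : ℕ) = 0) ∧ (∑ j : Fin 3, (1 - Real.cos (2 * Real.pi * ((q j : ℕ) : ℝ) / (K : ℝ)))) < θ), Literature.MathematicalPhysics.QuantumManyBody.BoseGas.cellOccupation N (Literature.MathematicalPhysics.QuantumManyBody.BoseGas.sideLength ρ N) (fun x : EuclideanSpace ℝ (Fin 3) => (((Real.sqrt (Literature.MathematicalPhysics.QuantumManyBody.BoseGas.sideLength ρ N ^ 3))⁻¹ : ℝ) : ℂ) * Complex.exp (((2 * Real.pi * (∑ j : Fin 3, ((q j : ℕ) : ℝ) * (⌊(K : ℝ) * x j / Literature.MathematicalPhysics.QuantumManyBody.BoseGas.sideLength ρ N⌋ : ℝ)) / (K : ℝ) : ℝ) : ℂ) * Complex.I)) Ψ.ψ ≤ ENNReal.ofReal (C / (∑ j : Fin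 3, (1 - Real.cos (2 * Real.pi * ((q j : ℕ) : ℝ) / (K : ℝ))))) * (1 + Literature.MathematicalPhysics.QuantumManyBody.BoseGas.structureFactorVar N (Literature.MathematicalPhysics.QuantumManyBody.BoseGas.sideLength ρ N) ((Literature.MathematicalPhysics.QuantumManyBody.BoseGas.cellN N (Literature.MathematicalPhysics.QuantumManyBody.BoseGas.sideLength ρ N)).indicator Ψ.ψ) (fun j : Fin 3 => if 2 * (q j : ℕ) ≤ K then (((q j : ℕ) : ℤ)) else (((q j : ℕ) : ℤ) - (K : ℤ))) / (N : ENNReal))) (B)` -/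

/-- **A is discharged onto the shared crux**: `TorusHyperuniformity (stmt-9093) → (∀ v : ℝ → ENNReal, Literature.MathematicalPhysics.QuantumManyBody.BoseGas.IsRepulsiveFiniteRange v → ∃ κ : ℝ, 0 < κ ∧ ∃ σ : ℝ, 0 < σ ∧ ∃ ρ₀ : ℝ, 0 < ρ₀ ∧ ∀ ρ : ℝ, 0 < ρ → ρ < ρ₀ → ∀ᶠ N : ℕ in Filter.atTop, ∃ δ : ENNReal, 0 < δ ∧ ∀ Ψ : Literature.MathematicalPhysics.QuantumManyBody.BoseGas.PeriodicTrialState N (Literature.MathematicalPhysics.QuantumManyBody.BoseGas.sideLength ρ N), Literature.MathematicalPhysics.QuantumManyBody.BoseGas.periodicEnergy v Ψ ≤ Literature.MathematicalPhysics.QuantumManyBody.BoseGas.periodicGroundStateEnergy v N (Literature.MathematicalPhysics.QuantumManyBody.BoseGas.sideLength ρ N) + δ → ∀ m : Fin 3 → ℤ, m ≠ 0 → (∀ j : Fin 3, |((m j : ℤ) : ℝ)| ≤ κ * Real.sqrt ρ * Literature.MathematicalPhysics.QuantumManyBody.BoseGas.sideLength ρ N) → Literature.MathematicalPhysics.QuantumManyBody.BoseGas.structureFactorVar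 N (Literature.MathematicalPhysics.QuantumManyBody.BoseGas.sideLength ρ N) ((Literature.MathematicalPhysics.QuantumManyBody.BoseGas.cellN N (Literature.MathematicalPhysics.QuantumManyBody.BoseGas.sideLength ρ N)).indicator Ψ.ψ) m ≤ ENNReal.ofReal σ * (N : ENNReal))` (all admissible `v`:
`a > 0` through 9093's window, `a = 0` by the proved free leaf). -/
theorem deepDensityFlatness_of_torusHyperuniformity
    (hTH : Summit.AtomisticToContinuum.BoseEinsteinCondensation.Theses.BECSectorPoincareTwoScale.TorusHyperuniformity) :
    (∀ v : ℝ → ENNReal, Literature.MathematicalPhysics.QuantumManyBody.BoseGas.IsRepulsiveFiniteRange v → ∃ κ : ℝ, 0 < κ ∧ ∃ σ : ℝ, 0 < σ ∧ ∃ ρ₀ : ℝ, 0 < ρ₀ ∧ ∀ ρ : ℝ, 0 < ρ → ρ < ρ₀ → ∀ᶠ N : ℕ in Filter.atTop, ∃ δ : ENNReal, 0 < δ ∧ ∀ Ψ : Literature.MathematicalPhysics.QuantumManyBody.BoseGas.PeriodicTrialState N (Literature.MathematicalPhysics.QuantumManyBody.BoseGas.sideLength ρ N), Literature.MathematicalPhysics.QuantumManyBody.BoseGas.periodicEnergy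 v Ψ ≤ Literature.MathematicalPhysics.QuantumManyBody.BoseGas.periodicGroundStateEnergy v N (Literature.MathematicalPhysics.QuantumManyBody.BoseGas.sideLength ρ N) + δ → ∀ m : Fin 3 → ℤ, m ≠ 0 → (∀ j : Fin 3, |((m j : ℤ) : ℝ)| ≤ κ * Real.sqrt ρ * Literature.MathematicalPhysics.QuantumManyBody.BoseGas.sideLength ρ N) → Literature.MathematicalPhysics.QuantumManyBody.BoseGas.structureFactorVar N (Literature.MathematicalPhysics.QuantumManyBody.BoseGas.sideLength ρ N) ((Literature.MathematicalPhysics.QuantumManyBody.BoseGas.cellN N (Literature.MathematicalPhysics.QuantumManyBody.BoseGas.sideLength ρ N)).indicator Ψ.ψ) m ≤ ENNReal.ofReal σ * (N : ENNReal)) :=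
  deepDensityFlatness_of_torusHyperuniformity_free hTH Summit.AtomisticToContinuum.BoseEinsteinCondensation.Theorems.DeepInfraredEmptinessFreeFlatness.freeDensityFlatness_holds

/-- **The node, by name**: `BECSectorPoincareTwoScale.TorusHyperuniformity (stmt-AtomisticToContinuum-9093, shared open crux)
→ (∀ v : ℝ → ENNReal, Literature.MathematicalPhysics.QuantumManyBody.BoseGas.IsRepulsiveFiniteRange v → ∃ A : ℝ, 0 < A ∧ ∃ θ : ℝ, 0 < θ ∧ ∃ C : ℝ, 0 < C ∧ ∃ ρ₀ : ℝ, 0 < ρ₀ ∧ ∀ ρ : ℝ, 0 < ρ → ρ < ρ₀ → ∀ᶠ N : ℕ in Filter.atTop, ∃ δ : ENNReal, 0 < δ ∧ ∀ Ψ : Literature.MathematicalPhysics.QuantumManyBody.BoseGas.PeriodicTrialState N (Literature.MathematicalPhysics.QuantumManyBody.BoseGas.sideLength ρ N), Literature.MathematicalPhysics.QuantumManyBody.BoseGas.periodicEnergy v Ψ ≤ Literature.MathematicalPhysics.QuantumManyBody.BoseGas.periodicGroundStateEnergy v N (Literature.MathematicalPhysics.QuantumManyBody.BoseGas.sideLength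 ρ N) + δ → ∀ K : ℕ, Even K → 0 < K → A / Real.sqrt ρ ≤ Literature.MathematicalPhysics.QuantumManyBody.BoseGas.sideLength ρ N / (K : ℝ) ∧ Literature.MathematicalPhysics.QuantumManyBody.BoseGas.sideLength ρ N / (K : ℝ) ≤ 2 * A / Real.sqrt ρ → ∀ q ∈ (Finset.univ.filter fun q : Fin 3 → Fin K => ¬ (∀ j : Fin 3, (q j : ℕ) = 0) ∧ (∑ j : Fin 3, (1 - Real.cos (2 * Real.pi * ((q j : ℕ) : ℝ) / (K : ℝ)))) < θ), Literature.MathematicalPhysics.QuantumManyBody.BoseGas.cellOccupation N (Literature.MathematicalPhysics.QuantumManyBody.BoseGas.sideLength ρ N) (fun x : EuclideanSpace ℝ (Fin 3) => (((Real.sqrt (Literature.MathematicalPhysics.QuantumManyBody.BoseGas.sideLength ρ N ^ 3))⁻¹ : ℝ) : ℂ) * Complex.exp (((2 * Real.pi * (∑ j : Fin 3, ((q j : ℕ) : ℝ) * (⌊(K : ℝ) * x j / Literature.MathematicalPhysics.QuantumManyBody.BoseGas.sideLength ρ N⌋ : ℝ)) / (K : ℝ) : ℝ) : ℂ) * Complex.I))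 Ψ.ψ ≤ ENNReal.ofReal (C / (∑ j : Fin 3, (1 - Real.cos (2 * Real.pi * ((q j : ℕ) : ℝ) / (K : ℝ))))) * (1 + Literature.MathematicalPhysics.QuantumManyBody.BoseGas.structureFactorVar N (Literature.MathematicalPhysics.QuantumManyBody.BoseGas.sideLength ρ N) ((Literature.MathematicalPhysics.QuantumManyBody.BoseGas.cellN N (Literature.MathematicalPhysics.QuantumManyBody.BoseGas.sideLength ρ N)).indicator Ψ.ψ) (fun j : Fin 3 => if 2 * (q j : ℕ) ≤ K then (((q j : ℕ) : ℤ)) else (((q j : ℕ) : ℤ) - (K : ℤ))) / (N : ENNReal))) (residual B, strictly weaker than the target) → BlockLatticeFSum.DeepInfraredEmptiness`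
(route decl, stmt-AtomisticToContinuum-27506). -/
theorem deepInfraredEmptiness_of_torusHyperuniformity_gain
    (hTH : Summit.AtomisticToContinuum.BoseEinsteinCondensation.Theses.BECSectorPoincareTwoScale.TorusHyperuniformity)
    (hB : (∀ v : ℝ → ENNReal, Literature.MathematicalPhysics.QuantumManyBody.BoseGas.IsRepulsiveFiniteRange v → ∃ A : ℝ, 0 < A ∧ ∃ θ : ℝ, 0 < θ ∧ ∃ C : ℝ, 0 < C ∧ ∃ ρ₀ : ℝ, 0 < ρ₀ ∧ ∀ ρ : ℝ, 0 < ρ → ρ < ρ₀ → ∀ᶠ N : ℕ in Filter.atTop, ∃ δ : ENNReal, 0 < δ ∧ ∀ Ψ : Literature.MathematicalPhysics.QuantumManyBody.BoseGas.PeriodicTrialState N (Literature.MathematicalPhysics.QuantumManyBody.BoseGas.sideLength ρ N), Literature.MathematicalPhysics.QuantumManyBody.BoseGas.periodicEnergy v Ψ ≤ Literature.MathematicalPhysics.QuantumManyBody.BoseGas.periodicGroundStateEnergy v N (Literature.MathematicalPhysics.QuantumManyBody.BoseGas.sideLength ρ N) + δ → ∀ K : ℕ, Even K → 0 < K → A /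 Real.sqrt ρ ≤ Literature.MathematicalPhysics.QuantumManyBody.BoseGas.sideLength ρ N / (K : ℝ) ∧ Literature.MathematicalPhysics.QuantumManyBody.BoseGas.sideLength ρ N / (K : ℝ) ≤ 2 * A / Real.sqrt ρ → ∀ q ∈ (Finset.univ.filter fun q : Fin 3 → Fin K => ¬ (∀ j : Fin 3, (q j : ℕ) = 0) ∧ (∑ j : Fin 3, (1 - Real.cos (2 * Real.pi * ((q j : ℕ) : ℝ) / (K : ℝ)))) < θ), Literature.MathematicalPhysics.QuantumManyBody.BoseGas.cellOccupation N (Literature.MathematicalPhysics.QuantumManyBody.BoseGas.sideLength ρ N) (fun x : EuclideanSpace ℝ (Fin 3) => (((Real.sqrt (Literature.MathematicalPhysics.QuantumManyBody.BoseGas.sideLength ρ N ^ 3))⁻¹ : ℝ) : ℂ) * Complex.exp (((2 * Real.pi * (∑ j : Fin 3, ((q j : ℕ) : ℝ) * (⌊(K : ℝ) * x j / Literature.MathematicalPhysics.QuantumManyBody.BoseGas.sideLength ρ N⌋ : ℝ)) / (K : ℝ) : ℝ) : ℂ) * Complex.I)) Ψ.ψ ≤ ENNReal.ofReal (C / (∑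 j : Fin 3, (1 - Real.cos (2 * Real.pi * ((q j : ℕ) : ℝ) / (K : ℝ))))) * (1 + Literature.MathematicalPhysics.QuantumManyBody.BoseGas.structureFactorVar N (Literature.MathematicalPhysics.QuantumManyBody.BoseGas.sideLength ρ N) ((Literature.MathematicalPhysics.QuantumManyBody.BoseGas.cellN N (Literature.MathematicalPhysics.QuantumManyBody.BoseGas.sideLength ρ N)).indicator Ψ.ψ) (fun j : Fin 3 => if 2 * (q j : ℕ) ≤ K then (((q j : ℕ) : ℤ)) else (((q j : ℕ) : ℤ) - (K : ℤ))) / (N : ENNReal)))) :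
    Summit.AtomisticToContinuum.BoseEinsteinCondensation.Theses.BlockLatticeFSum.DeepInfraredEmptiness :=
  deepInfraredEmptiness_of_torusHyperuniformity_free_gain hTH Summit.AtomisticToContinuum.BoseEinsteinCondensation.Theorems.DeepInfraredEmptinessFreeFlatness.freeDensityFlatness_holds hB

/-- The registered core stub `stub_deepPointwiseOne` (skeleton 6417f3f1 on stmt-27506) from the same two inputs. -/
theorem deepPointwiseOne_of_torusHyperuniformity_gain
    (hTH : Summit.AtomisticToContinuum.BoseEinsteinCondensation.Theses.BECSectorPoincareTwoScale.TorusHyperuniformity)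
    (hB : (∀ v : ℝ → ENNReal, Literature.MathematicalPhysics.QuantumManyBody.BoseGas.IsRepulsiveFiniteRange v → ∃ A : ℝ, 0 < A ∧ ∃ θ : ℝ, 0 < θ ∧ ∃ C : ℝ, 0 < C ∧ ∃ ρ₀ : ℝ, 0 < ρ₀ ∧ ∀ ρ : ℝ, 0 < ρ → ρ < ρ₀ → ∀ᶠ N : ℕ in Filter.atTop, ∃ δ : ENNReal, 0 < δ ∧ ∀ Ψ : Literature.MathematicalPhysics.QuantumManyBody.BoseGas.PeriodicTrialState N (Literature.MathematicalPhysics.QuantumManyBody.BoseGas.sideLength ρ N), Literature.MathematicalPhysics.QuantumManyBody.BoseGas.periodicEnergy v Ψ ≤ Literature.MathematicalPhysics.QuantumManyBody.BoseGas.periodicGroundStateEnergy v N (Literature.MathematicalPhysics.QuantumManyBody.BoseGas.sideLength ρ N) + δ → ∀ K : ℕ, Even K → 0 < K → A / Real.sqrt ρ ≤ Literature.MathematicalPhysics.QuantumManyBody.BoseGas.sideLength ρ N / (K : ℝ) ∧ Literature.MathematicalPhysics.QuantumManyBody.BoseGas.sideLength ρ N / (K : ℝ) ≤ 2 * A / Real.sqrt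 ρ → ∀ q ∈ (Finset.univ.filter fun q : Fin 3 → Fin K => ¬ (∀ j : Fin 3, (q j : ℕ) = 0) ∧ (∑ j : Fin 3, (1 - Real.cos (2 * Real.pi * ((q j : ℕ) : ℝ) / (K : ℝ)))) < θ), Literature.MathematicalPhysics.QuantumManyBody.BoseGas.cellOccupation N (Literature.MathematicalPhysics.QuantumManyBody.BoseGas.sideLength ρ N) (fun x : EuclideanSpace ℝ (Fin 3) => (((Real.sqrt (Literature.MathematicalPhysics.QuantumManyBody.BoseGas.sideLength ρ N ^ 3))⁻¹ : ℝ) : ℂ) * Complex.exp (((2 * Real.pi * (∑ j : Fin 3, ((q j : ℕ) : ℝ) * (⌊(K : ℝ) * x j / Literature.MathematicalPhysics.QuantumManyBody.BoseGas.sideLength ρ N⌋ : ℝ)) / (K : ℝ) : ℝ) : ℂ) * Complex.I)) Ψ.ψ ≤ ENNReal.ofReal (C / (∑ j : Fin 3, (1 - Real.cos (2 * Real.pi * ((q j : ℕ) : ℝ) / (K : ℝ))))) * (1 + Literature.MathematicalPhysics.QuantumManyBody.BoseGas.structureFactorVar N (Literature.MathematicalPhysics.QuantumManyBody.BoseGas.sideLength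 ρ N) ((Literature.MathematicalPhysics.QuantumManyBody.BoseGas.cellN N (Literature.MathematicalPhysics.QuantumManyBody.BoseGas.sideLength ρ N)).indicator Ψ.ψ) (fun j : Fin 3 => if 2 * (q j : ℕ) ≤ K then (((q j : ℕ) : ℤ)) else (((q j : ℕ) : ℤ) - (K : ℤ))) / (N : ENNReal)))) : (∀ v : ℝ → ENNReal, Literature.MathematicalPhysics.QuantumManyBody.BoseGas.IsRepulsiveFiniteRange v → ∃ A : ℝ, 0 < A ∧ ∃ θ : ℝ, 0 < θ ∧ ∃ C : ℝ, 0 < C ∧ ∃ ρ₀ : ℝ, 0 < ρ₀ ∧ ∀ ρ : ℝ, 0 < ρ → ρ < ρ₀ → ∀ᶠ N : ℕ in Filter.atTop, ∃ δ : ENNReal, 0 < δ ∧ ∀ Ψ : Literature.MathematicalPhysics.QuantumManyBody.BoseGas.PeriodicTrialState N (Literature.MathematicalPhysics.QuantumManyBody.BoseGas.sideLength ρ N), Literature.MathematicalPhysics.QuantumManyBody.BoseGas.periodicEnergy v Ψ ≤ Literature.MathematicalPhysics.QuantumManyBody.BoseGas.periodicGroundStateEnergy v N (Literature.MathematicalPhysics.QuantumManyBody.BoseGas.sideLength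 ρ N) + δ → ∀ K : ℕ, Even K → 0 < K → A / Real.sqrt ρ ≤ Literature.MathematicalPhysics.QuantumManyBody.BoseGas.sideLength ρ N / (K : ℝ) ∧ Literature.MathematicalPhysics.QuantumManyBody.BoseGas.sideLength ρ N / (K : ℝ) ≤ 2 * A / Real.sqrt ρ → ∀ q ∈ (Finset.univ.filter fun q : Fin 3 → Fin K => ¬ (∀ j : Fin 3, (q j : ℕ) = 0) ∧ (∑ j : Fin 3, (1 - Real.cos (2 * Real.pi * ((q j : ℕ) : ℝ) / (K : ℝ)))) < θ), Literature.MathematicalPhysics.QuantumManyBody.BoseGas.cellOccupation N (Literature.MathematicalPhysics.QuantumManyBody.BoseGas.sideLength ρ N) (fun x : EuclideanSpace ℝ (Fin 3) => (((Real.sqrt (Literature.MathematicalPhysics.QuantumManyBody.BoseGas.sideLength ρ N ^ 3))⁻¹ : ℝ) : ℂ) * Complex.exp (((2 * Real.pi * (∑ j : Fin 3, ((q j : ℕ) : ℝ) * (⌊(K : ℝ) * x j / Literature.MathematicalPhysics.QuantumManyBody.BoseGas.sideLength ρ N⌋ : ℝ)) / (K : ℝ) : ℝ) : ℂ) * Complex.I))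 Ψ.ψ ≤ ENNReal.ofReal (C / (∑ j : Fin 3, (1 - Real.cos (2 * Real.pi * ((q j : ℕ) : ℝ) / (K : ℝ)))))) :=
  deepPointwiseOne_of_torusHyperuniformity_free_gain hTH Summit.AtomisticToContinuum.BoseEinsteinCondensation.Theorems.DeepInfraredEmptinessFreeFlatness.freeDensityFlatness_holds hB

end Summit.AtomisticToContinuum.BoseEinsteinCondensation.Theorems.DeepInfraredEmptinessHyperuniformCarving

end
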